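import Summits.QuantumFields.YangMills.Theorems.BalabanLadderIRTwistedSlabPrefactorNecessary
import HarnessLib

/-!
# T1's shape is TIGHT at tree level: the classical defect is at least `min(½, L·e^{−ω_max t}∕2)`, so every admissible rate satisfies
# `c ≤ ω_max = 2·arsinh √3` (a quantitative companion of K36's upper bound `C·L·e^{−ω_min t}` and of K44's «no `L`-free majorant»)

HELPER toward stub **T1** `TwistedSlabAnchor` of LINE `twisted-slab-continuity` (crux `IRcof`, stmt-QuantumFields-26930, census row 43;
LEAD prover ym-ir-line-tsc-p1 g6; `--supports` the crux, `--as helper`).  Theorems only.  K46 of the T1 programme.  With K36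
(`twistedSlabAnchor_treeLevel_uniform`: `lim_β projSlabDefect ≤ C·L·e^{−ct}`, `c = ω_min`) this pins the tree-level defect of the e₂-projected twisted slab of
`SU(N)` as `Θ(L·e^{−ωt})` in the regime `L e^{−ωt} ≲ 1`, up to the spread `ω_min ≤ ω ≤ ω_max` of the lattice dispersion at the twist eater.

* §1 `one_sub_pow_one_sub_ge_min` (`1 − (1−ε)^n ≥ min(½, nε∕2)`), `exp_neg_le_one_sub_ladderFreq_factor` (`1 − tanh²(t·(2arsinh(√λ∕2))∕2) ≥ e^{−ω_max t}` for `λ ≤ 12`, `t ≥ 0`), ★ `classicalDefect_ge_min` (abstract dispersion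
  `λ : P → Q → (−∞, 12]`: `1 − ∏_p∏_q tanh²(t·(2arsinh(√λ∕2))∕2) ≥ min(½, #Q·e^{−ω_max t}∕2)` with `ω_max = 2arsinh(√12∕2)`);
* §2 ★★ `eventually_projSlabDefect_gt` — for `N ≥ 2`, `k` a unit, `n ≥ 1`, `(ω^k·1)^n = 1` and EVERY box `(m+1)² × (m₂+1) × (m₃+1)`: eventually in `β`,
  `projSlabDefect(fund; β, ω^k·1, n, m+1, m₂+1, m₃+1) > δ` for every `δ < min(½, (m₂+1)·e^{−ω_max (m₃+1)}∕2)` (THE NUMBER K31d + §1);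
  ★★★ `twistedSlabAnchor_rate_le_omegaMax` — if a T1-type bound `projSlabDefect ≤ C·(m₂+1)·e^{−ct}` holds for all `β ≥ β₀`, all `m₂` and all `t ≥ 1`, then
  `c ≤ ω_max = 2·arsinh(√12∕2)`: the decay rate of the stub cannot beat the top of the tree-level dispersion.

HONEST FRAMING: statements about the SHAPE of T1 read off the classical limit; nothing here is an estimate uniform in `L` at finite `β`; T1 (M4) 0∕1;
IRcof ∕ IR 0∕1; the Yang–Mills mass gap (Clay) is NOT proved; R4 = `BalabanLadder.UV` only.
References: G. 't Hooft, Nucl. Phys. B 153 (1979) §5; M. García Pérez, A. González-Arroyo, M. Okawa, IJMPA 29 (2014) 1445001 §3.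
-/

set_option autoImplicit false

noncomputable section

open Filter Topology Finset
open scoped BigOperators
open Literature.MathematicalPhysics.QuantumFieldTheory Literature.MathematicalPhysics.QuantumLattice
open Literature.Analysis.Matrix.TwistedCycleLaplacian
open Literature.Combinatorics.SimpleGraph (cycleAngle)

namespace Summit.QuantumFields.YangMills.Cruxes.IRcof.TwistedSlab

/-! ## §1 Elementary lower bounds -/

/-- `1 − (1 − ε)^n ≥ min(½, nε∕2)` for `0 ≤ ε ≤ 1`. [folklore] -/
theorem one_sub_pow_one_sub_ge_min {ε : ℝ} (h0 : 0 ≤ ε) (h1 : ε ≤ 1) (n : ℕ) :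
    min (1 / 2) ((n : ℝ) * ε / 2) ≤ 1 - (1 - ε) ^ n := by
  have hle : (1 - ε) ^ n ≤ Real.exp (-((n : ℝ) * ε)) := by
    have h2 : 1 - ε ≤ Real.exp (-ε) := by have := Real.add_one_le_exp (-ε); linarith
    calc (1 - ε) ^ n ≤ Real.exp (-ε) ^ n := pow_le_pow_left₀ (by linarith) h2 n
      _ = Real.exp (-((n : ℝ) * ε)) := by rw [← Real.exp_nat_mul]; ring_nf
  -- `1 − e^{−x} ≥ x/(1+x) ≥ min(½, x/2)` at `x = nε` (the tree's `Linnik.min_half_le_one_sub_exp_neg`, inlined to keep the import graph local)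
  have hx : 0 ≤ (n : ℝ) * ε := by positivity
  have hX := Real.add_one_le_exp ((n : ℝ) * ε)
  have hpos := Real.exp_pos ((n : ℝ) * ε)
  have hinv : Real.exp (-((n : ℝ) * ε)) = (Real.exp ((n : ℝ) * ε))⁻¹ := Real.exp_neg _
  have hprod : Real.exp (-((n : ℝ) * ε)) * Real.exp ((n : ℝ) * ε) = 1 := by rw [hinv, inv_mul_cancel₀ hpos.ne']
  have hE0 := Real.exp_pos (-((n : ℝ) * ε))
  -- `e^{−x}(1 + x) ≤ 1`
  have hkey : Real.exp (-((n : ℝ) * ε)) * (1 + (n : ℝ) * ε) ≤ 1 := by nlinarith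
  rcases le_total ((n : ℝ) * ε) 1 with h | h
  · have : (n : ℝ) * ε / 2 ≤ 1 - Real.exp (-((n : ℝ) * ε)) := by nlinarith
    exact (min_le_right _ _).trans (this.trans (by linarith))
  · have : (1 : ℝ) / 2 ≤ 1 - Real.exp (-((n : ℝ) * ε)) := by nlinarith
    exact (min_le_left _ _).trans (this.trans (by linarith))

/-- **Every factor of THE NUMBER leaves room `e^{−ω_max t}`**: for `t ≥ 0` and `λ ≤ 12`,
`e^{−t·(2arsinh(√12∕2))} ≤ 1 − tanh²(t·(2arsinh(√λ∕2))∕2)`. [cite: GarciaperezGonzalezarroyoOkawa2014, §3] -/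
theorem exp_neg_le_one_sub_ladderFreq_factor {t : ℝ} (ht : 0 ≤ t) {lam : ℝ} (h12 : lam ≤ 12) :
    Real.exp (-(t * (2 * Real.arsinh (Real.sqrt 12 / 2)))) ≤
      1 - Real.tanh (t * (2 * Real.arsinh (Real.sqrt lam / 2)) / 2) ^ 2 := by
  have hfac := ladderFreq_factor_le ht h12
  -- `1 − tanh²(y_max) = 1/cosh²(y_max) ≥ e^{−2 y_max}`
  set y : ℝ := t * (2 * Real.arsinh (Real.sqrt 12 / 2)) / 2 with hy
  have hy0 : 0 ≤ y := by
    have : 0 ≤ Real.arsinh (Real.sqrt 12 / 2) := Real.arsinh_nonneg_iff.2 (by positivity)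
    rw [hy]; positivity
  have hc := Real.cosh_pos y
  have hcosh : Real.cosh y ≤ Real.exp y := by
    rw [Real.cosh_eq]
    have : Real.exp (-y) ≤ Real.exp y := Real.exp_le_exp.2 (by linarith)
    linarith
  have hid := one_sub_tanh_sq_eq_inv_cosh_sq y
  have hsq : Real.cosh y ^ 2 ≤ Real.exp y ^ 2 := pow_le_pow_left₀ hc.le hcosh 2
  have hinv : (Real.exp y ^ 2)⁻¹ ≤ (Real.cosh y ^ 2)⁻¹ := inv_anti₀ (by positivity) hsq
  have hexp : Real.exp (-(t * (2 * Real.arsinh (Real.sqrt 12 / 2)))) = (Real.exp y ^ 2)⁻¹ := by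
    rw [← Real.exp_nat_mul, ← Real.exp_neg, hy]; ring_nf
  rw [hexp]
  linarith

/-- ★ **THE NUMBER is bounded BELOW on long boxes**: for a dispersion `λ : P → Q → (−∞,12]`, `t ≥ 0` and any row `p₀`,
`min(½, #Q·e^{−ω_max t}∕2) ≤ 1 − ∏_p ∏_q tanh²(t·(2arsinh(√λ_{p,q}∕2))∕2)`, `ω_max = 2arsinh(√12∕2)`. [cite: GarciaperezGonzalezarroyoOkawa2014, §3] -/
theorem classicalDefect_ge_min {P Q : Type*} [Fintype P] [Fintype Q] [DecidableEq P] {t : ℝ} (ht : 0 ≤ t)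
    (lam : P → Q → ℝ) (h12 : ∀ p q, lam p q ≤ 12) (p₀ : P) :
    min (1 / 2) ((Fintype.card Q : ℝ) * Real.exp (-(t * (2 * Real.arsinh (Real.sqrt 12 / 2)))) / 2) ≤
      1 - ∏ p, ∏ q, Real.tanh (t * (2 * Real.arsinh (Real.sqrt (lam p q) / 2)) / 2) ^ 2 := by
  set ε : ℝ := Real.exp (-(t * (2 * Real.arsinh (Real.sqrt 12 / 2)))) with hε
  have hε0 : 0 ≤ ε := (Real.exp_pos _).le
  have hε1 : ε ≤ 1 := by
    rw [hε]
    have : 0 ≤ t * (2 * Real.arsinh (Real.sqrt 12 / 2)) := by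
      have : 0 ≤ Real.arsinh (Real.sqrt 12 / 2) := Real.arsinh_nonneg_iff.2 (by positivity)
      positivity
    exact Real.exp_le_one_iff.2 (by linarith)
  have hprod := prod_prod_le_pow_card (fun p q => Real.tanh (t * (2 * Real.arsinh (Real.sqrt (lam p q) / 2)) / 2) ^ 2)
    (fun p q => sq_nonneg _) (fun p q => tanh_sq_le_one' _) p₀ (τ := 1 - ε)
    (fun q => by linarith [exp_neg_le_one_sub_ladderFreq_factor ht (h12 p₀ q)])
  have hmin := one_sub_pow_one_sub_ge_min hε0 hε1 (Fintype.card Q)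
  linarith

/-! ## §2 The lattice: eventual lower bound and the rate ceiling -/

variable {N : ℕ} [NeZero N] {k : ZMod N}

/-- ★★ **EVENTUAL LOWER BOUND ON THE PROJECTED DEFECT.**  For `N ≥ 2`, `k` a unit, `n ≥ 1`, `(ω^k·1)^n = 1` and every box: for every
`δ < min(½, (m₂+1)·e^{−ω_max (m₃+1)}∕2)`, eventually in `β` the defect `projSlabDefect(fund; β, ω^k·1, n, m+1, m₂+1, m₃+1)` exceeds `δ`
(its `β → ∞` limit is THE NUMBER, K31d, which §1 bounds below; `ω_max = 2arsinh(√12∕2)`). [cite: tHooft1979Flux, §5 (5.1)–(5.4)]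
[cite: GarciaperezGonzalezarroyoOkawa2014, §3] -/
theorem eventually_projSlabDefect_gt (hN : 2 ≤ N) (hk : IsUnit k) {n : ℕ} (hn : 0 < n)
    (hzn : (suCenter N k : Matrix.specialUnitaryGroup (Fin N) ℂ) ^ n = 1) (m m₂ m₃ : ℕ) {δ : ℝ}
    (hδ : δ < min (1 / 2) (((m₂ + 1 : ℕ) : ℝ) * Real.exp (-(((m₃ + 1 : ℕ) : ℝ) * (2 * Real.arsinh (Real.sqrt 12 / 2)))) / 2)) :
    ∀ᶠ β : ℝ in atTop, δ < projSlabDefect (fundamentalRep (Fin N)) β (suCenter N k : Matrix.specialUnitaryGroup (Fin N) ℂ) n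
      (m + 1) (m₂ + 1) (m₃ + 1) := by
  obtain ⟨⟨A', B', hAB'⟩, -, -⟩ := hasIsolatingTwist_suCenter (N := N) hk
  have hlim := tendsto_projSlabDefect_tanh (m := m) (m₂ := m₂) (m₃ := m₃) hN hk hn hzn hAB'
  have hp₀ : ((0 : Fin N), (⟨1, by omega⟩ : Fin N)) ≠ (0, 0) := by
    intro h
    have h2 : (((⟨1, by omega⟩ : Fin N) : Fin N) : ℕ) = ((0 : Fin N) : ℕ) := by rw [(Prod.mk.inj h).2]
    simp at h2
  -- the limit `V` is at least `min(½, #Q e^{−ω_max t}/2)` with `#Q = (m+1)²(m₂+1) ≥ m₂+1`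
  obtain ⟨V, hlimV, hV⟩ : ∃ V : ℝ, Tendsto (fun β : ℝ => projSlabDefect (fundamentalRep (Fin N)) β
      (suCenter N k : Matrix.specialUnitaryGroup (Fin N) ℂ) n (m + 1) (m₂ + 1) (m₃ + 1)) atTop (𝓝 V) ∧
      min (1 / 2) ((((m + 1) * ((m + 1) * (m₂ + 1)) : ℕ) : ℝ) *
        Real.exp (-(((m₃ + 1 : ℕ) : ℝ) * (2 * Real.arsinh (Real.sqrt 12 / 2)))) / 2) ≤ V := by
    refine ⟨_, hlim, ?_⟩
    simpa only [Fintype.card_prod, Fintype.card_fin] using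
      classicalDefect_ge_min (P := {p : Fin N × Fin N // p ≠ (0, 0)}) (Q := Fin (m + 1) × Fin (m + 1) × Fin (m₂ + 1))
        (t := ((m₃ + 1 : ℕ) : ℝ)) (Nat.cast_nonneg _)
        (fun p q => (2 - 2 * Real.cos (-(2 * Real.pi * (k.val : ℝ) / N) * (p.1.2 : ℕ) / (m + 1 : ℕ) + cycleAngle (m + 1) q.1)) +
          ((2 - 2 * Real.cos ((2 * Real.pi * (k.val : ℝ) / N) * (p.1.1 : ℕ) / (m + 1 : ℕ) + cycleAngle (m + 1) q.2.1)) +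
            (2 - 2 * Real.cos (0 + cycleAngle (m₂ + 1) q.2.2))))
        (fun p q => (three_cos_dispersion_bounds _ _ _).2) ⟨_, hp₀⟩
  -- monotonicity of the `min` in the mode count
  have hcount : ((m₂ + 1 : ℕ) : ℝ) ≤ (((m + 1) * ((m + 1) * (m₂ + 1)) : ℕ) : ℝ) := by
    have h1 : m₂ + 1 ≤ (m + 1) * ((m + 1) * (m₂ + 1)) := by
      have ha : m₂ + 1 ≤ (m + 1) * (m₂ + 1) := Nat.le_mul_of_pos_left _ (by positivity)
      have hb : (m + 1) * (m₂ + 1) ≤ (m + 1) * ((m + 1) * (m₂ + 1)) := Nat.le_mul_of_pos_left _ (by positivity)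
      omega
    exact_mod_cast h1
  have hE := Real.exp_pos (-(((m₃ + 1 : ℕ) : ℝ) * (2 * Real.arsinh (Real.sqrt 12 / 2))))
  have hmono : min (1 / 2) (((m₂ + 1 : ℕ) : ℝ) * Real.exp (-(((m₃ + 1 : ℕ) : ℝ) * (2 * Real.arsinh (Real.sqrt 12 / 2)))) / 2) ≤
      min (1 / 2) ((((m + 1) * ((m + 1) * (m₂ + 1)) : ℕ) : ℝ) *
        Real.exp (-(((m₃ + 1 : ℕ) : ℝ) * (2 * Real.arsinh (Real.sqrt 12 / 2)))) / 2) :=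
    min_le_min le_rfl (by nlinarith)
  have hδV : δ < V := lt_of_lt_of_le hδ (hmono.trans hV)
  exact hlimV.eventually (Ioi_mem_nhds hδV)

/-- ★★★ **THE RATE CEILING**: for `N ≥ 2`, `k` a unit, `n ≥ 1`, `(ω^k·1)^n = 1`, every `ℓ₀ = m+1`: if a T1-type bound
`projSlabDefect(fund; β, ω^k·1, n, ℓ₀, m₂+1, t) ≤ C·(m₂+1)·e^{−ct}` holds for all `β ≥ β₀`, all `m₂` and all `t ≥ 1`, then `c ≤ ω_max = 2·arsinh(√12∕2)` —
the stub's decay rate cannot exceed the top of the tree-level dispersion at the twist eater. [cite: tHooft1979Flux, §5 (5.1)–(5.4)]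
[cite: GarciaperezGonzalezarroyoOkawa2014, §3] -/
theorem twistedSlabAnchor_rate_le_omegaMax (hN : 2 ≤ N) (hk : IsUnit k) {n : ℕ} (hn : 0 < n)
    (hzn : (suCenter N k : Matrix.specialUnitaryGroup (Fin N) ℂ) ^ n = 1) (m : ℕ) {β₀ c C : ℝ}
    (h : ∀ β : ℝ, β₀ ≤ β → ∀ m₂ t : ℕ, 1 ≤ t →
      projSlabDefect (fundamentalRep (Fin N)) β (suCenter N k : Matrix.specialUnitaryGroup (Fin N) ℂ) n (m + 1) (m₂ + 1) t ≤
        C * ((m₂ + 1 : ℕ) : ℝ) * Real.exp (-(c * (t : ℝ)))) :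
    c ≤ 2 * Real.arsinh (Real.sqrt 12 / 2) := by
  set ω : ℝ := 2 * Real.arsinh (Real.sqrt 12 / 2) with hω
  by_contra hle_c
  have hlt : ω < c := not_le.mp hle_c
  -- along `t → ∞` with `m₂ = 0` (L = 1): `C e^{−ct} ≥ min(½, e^{−ωt}/2) − slack` eventually in β, impossible for `c > ω`
  -- choose `t` with `C·e^{−(c−ω)t} < 1/4` and `e^{−ωt}/2 ≤ 1/2`
  have hcω : 0 < c - ω := by linarith
  have hT : Tendsto (fun t : ℕ => C * Real.exp (-((c - ω) * (t : ℝ)))) atTop (𝓝 0) := by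
    have h1 : Tendsto (fun t : ℕ => (c - ω) * (t : ℝ)) atTop atTop := (tendsto_natCast_atTop_atTop).const_mul_atTop hcω
    simpa using (Real.tendsto_exp_neg_atTop_nhds_zero.comp h1).const_mul C
  obtain ⟨m₃, hm₃⟩ := (hT.eventually (gt_mem_nhds (show (0 : ℝ) < 1 / 4 by norm_num))).exists_forall_of_atTop
  have ht := hm₃ (m₃ + 1) (Nat.le_succ _)
  -- the eventual lower bound at the box `(m, 0, m₃)` with `δ := C e^{−c t}` (which is `< e^{−ω t}/4 < min(½, e^{−ωt}/2)`)
  have hEω := Real.exp_pos (-(((m₃ + 1 : ℕ) : ℝ) * ω))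
  have hEω1 : Real.exp (-(((m₃ + 1 : ℕ) : ℝ) * ω)) ≤ 1 := by
    have : 0 ≤ ((m₃ + 1 : ℕ) : ℝ) * ω := by
      have : 0 ≤ Real.arsinh (Real.sqrt 12 / 2) := Real.arsinh_nonneg_iff.2 (by positivity)
      rw [hω]; positivity
    exact Real.exp_le_one_iff.2 (by linarith)
  have hsplit : C * Real.exp (-(c * (((m₃ + 1 : ℕ) : ℝ)))) =
      C * Real.exp (-((c - ω) * ((m₃ + 1 : ℕ) : ℝ))) * Real.exp (-(((m₃ + 1 : ℕ) : ℝ) * ω)) := by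
    rw [mul_assoc, ← Real.exp_add]; ring_nf
  have hkey : C * Real.exp (-((c - ω) * ((m₃ + 1 : ℕ) : ℝ))) * Real.exp (-(((m₃ + 1 : ℕ) : ℝ) * ω)) <
      Real.exp (-(((m₃ + 1 : ℕ) : ℝ) * ω)) / 4 := by
    nlinarith [mul_pos (sub_pos.2 ht) hEω]
  have e1 : ((0 + 1 : ℕ) : ℝ) = 1 := by norm_num
  have hδ : C * ((0 + 1 : ℕ) : ℝ) * Real.exp (-(c * (((m₃ + 1 : ℕ) : ℝ)))) <
      min (1 / 2) (((0 + 1 : ℕ) : ℝ) * Real.exp (-(((m₃ + 1 : ℕ) : ℝ) * (2 * Real.arsinh (Real.sqrt 12 / 2)))) / 2) := by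
    rw [← hω, e1, mul_one, one_mul, hsplit, lt_min_iff]
    constructor <;> linarith
  have hev := (eventually_projSlabDefect_gt hN hk hn hzn m 0 m₃ hδ).and (eventually_ge_atTop β₀)
  obtain ⟨β, hβ, hββ₀⟩ := hev.exists
  have hle := h β hββ₀ 0 (m₃ + 1) (by omega)
  linarith

end Summit.QuantumFields.YangMills.Cruxes.IRcof.TwistedSlab

end
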